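import Mathlib
import Summits.KontsevichZagierPeriods.Zeta5Search.CasoratianClassBoundShift
import HarnessLib

/-!
# ζ(5) search — the CLASS ATLAS of the Brown–Zudilin record ray `b(n) = n·(41;17,…,11)` at the primes `14n < p < 15n`

Cell `pub-zeta5` (HONEST FRAMING: systematic search; no irrationality claim unless certified), P1 prover seat
generation 5; the combinatorial half of the Lean proof of census g11's `RecordCellA`.  For `n ≥ 1` and `14n < p < 15n`
(`3p > 41n`, so every residue class modulo `p` in `[0, 41n]` has two or three points `x < x+p (< x+2p)`):

* the depth / net-exponent table of the ray (`blockCount_bRec`, `dep7`, `netExp_bRec`), also for the shifted vector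
  `b(n) + e₇` away from the two positions `11n`, `30n` where it differs (`netExp_shift7`);
* the classes (`classSet_bRec`);
* the MINIMAL multipole classes (class exponent `−4`): `MinA` (type `(−1,−3)`: `12n ≤ x`, `x+p ≤ 27n`, `41n < x+2p`),
  `MinS` (type `(−2,−2)`: `13n ≤ x`, `x+p ≤ 28n`, not self-conjugate) and `MinAbar` (type `(−3,−1)` = the conjugates
  `41n − x − p` of `MinA`), with their net exponents (`netExp_minA`, `netExp_minS`);
* (part 2, `RecordCellAAtlasNotMin.lean`) every OTHER class has `ν_x ≥ −3`.
Exact arithmetic on the ray (all `n`); checked against gen-1's partial-fraction kernel for `n ≤ 7`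
(`code/cellA_check.py` of the P1 g5 session).  Nothing about irrationality.
-/

open Finset

namespace Summit.KontsevichZagierPeriods.Zeta5Search.CellA

open Summit.KontsevichZagierPeriods.Zeta5Search.ClusterValuation
open Summit.KontsevichZagierPeriods.Zeta5Search.CasoratianValuation (shift)
open Summit.KontsevichZagierPeriods.Zeta5Search.BigPrime (block shift_zero)

/-! ### §1 The depth table of the record ray -/

/-- `b(n)₀ = 41n`. -/
theorem bRec_zero (n : ℕ) : bRec n 0 = 41 * n := by simp [bRec]; ring

/-- `b(n)₀ = 41n` as a natural number. -/
theorem bRec_zero_toNat (n : ℕ) : (bRec n 0).toNat = 41 * n := by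
  rw [bRec_zero]; norm_cast

/-- The lower parameters: `b(n)_{j+1} = (17 − j)·n`, `j < 7`. -/
theorem bRec_succ_toNat (n j : ℕ) (hj : j < 7) : (bRec n (j + 1)).toNat = (17 - j) * n := by
  interval_cases j <;> simp [bRec] <;> norm_cast <;> ring_nf

/-- The depth of `q` on the record ray as an explicit indicator sum over the seven blocks `[ℓn, (41−ℓ)n]`, `ℓ = 17,…,11`. -/
def dep7 (n q : ℕ) : ℕ :=
  (if 17 * n ≤ q ∧ q ≤ 24 * n then 1 else 0) + (if 16 * n ≤ q ∧ q ≤ 25 * n then 1 else 0) +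
  (if 15 * n ≤ q ∧ q ≤ 26 * n then 1 else 0) + (if 14 * n ≤ q ∧ q ≤ 27 * n then 1 else 0) +
  (if 13 * n ≤ q ∧ q ≤ 28 * n then 1 else 0) + (if 12 * n ≤ q ∧ q ≤ 29 * n then 1 else 0) +
  (if 11 * n ≤ q ∧ q ≤ 30 * n then 1 else 0)

/-- **`blockCount (bRec n) q = dep7 n q`.** -/
theorem blockCount_bRec (n q : ℕ) : blockCount (bRec n) q = dep7 n q := by
  unfold blockCount dep7
  rw [card_filter, bRec_zero_toNat]
  simp only [sum_range_succ, sum_range_zero, zero_add, block, mem_Icc]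
  rw [bRec_succ_toNat n 0 (by norm_num), bRec_succ_toNat n 1 (by norm_num), bRec_succ_toNat n 2 (by norm_num),
    bRec_succ_toNat n 3 (by norm_num), bRec_succ_toNat n 4 (by norm_num), bRec_succ_toNat n 5 (by norm_num),
    bRec_succ_toNat n 6 (by norm_num)]
  simp only [← Nat.sub_mul]

/-- **Net exponents on the ray**: `netExp (bRec n) q = 1 − dep7 n q + [2q = 41n]`. -/
theorem netExp_bRec (n q : ℕ) :
    netExp (bRec n) q = 1 - (dep7 n q : ℤ) + (if 2 * q = 41 * n then 1 else 0) := by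
  unfold netExp
  rw [blockCount_bRec, bRec_zero]
  have : (2 * (q : ℤ) = 41 * (n : ℤ)) ↔ 2 * q = 41 * n := by omega
  simp only [this]

/-- Net exponent away from the centre. -/
theorem netExp_bRec_of_ne (n q : ℕ) (hc : 2 * q ≠ 41 * n) : netExp (bRec n) q = 1 - (dep7 n q : ℤ) := by
  rw [netExp_bRec, if_neg hc, add_zero]

/-- Below all blocks. -/
theorem dep7_low {n q : ℕ} (h : q < 11 * n) : dep7 n q = 0 := by
  unfold dep7; split_ifs <;> omega

/-- Above all blocks. -/
theorem dep7_high {n q : ℕ} (h : 30 * n < q) : dep7 n q = 0 := by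
  unfold dep7; split_ifs <;> omega

/-- Lower half: `k` blocks contain `q ∈ [(10+k)n, (11+k)n)`. -/
theorem dep7_lower {n q k : ℕ} (hk : k ≤ 7) (h1 : (10 + k) * n ≤ q) (h2 : q < (11 + k) * n) :
    dep7 n q = k := by
  interval_cases k <;> unfold dep7 <;> split_ifs <;> omega

/-- Upper half: `k` blocks contain `q ∈ ((30−k)n, (31−k)n]`. -/
theorem dep7_upper {n q k : ℕ} (hk : k ≤ 7) (h1 : (30 - k) * n < q) (h2 : q ≤ (31 - k) * n) :
    dep7 n q = k := by
  interval_cases k <;> unfold dep7 <;> split_ifs <;> omega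

/-- At least four blocks on `[14n, 27n]`. -/
theorem four_le_dep7 {n q : ℕ} (h1 : 14 * n ≤ q) (h2 : q ≤ 27 * n) : 4 ≤ dep7 n q := by
  unfold dep7; split_ifs <;> omega

/-- `dep7 ≤ 7`. -/
theorem dep7_le (n q : ℕ) : dep7 n q ≤ 7 := by
  unfold dep7; split_ifs <;> omega

/-! ### §2 The shifted vector `b(n) + e₇` -/

/-- `(b(n) + e₇)₀ = 41n`. -/
theorem shift7_zero_toNat (n : ℕ) : (shift (bRec n) 7 0).toNat = 41 * n := by
  rw [shift_zero _ (by norm_num), bRec_zero_toNat]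

/-- Away from `11n` and `30n` the shift `b₇ ↦ b₇ + 1` does not change the depth. -/
theorem blockCount_shift7 (n q : ℕ) (h1 : q ≠ 11 * n) (h2 : q ≠ 30 * n) :
    blockCount (shift (bRec n) 7) q = blockCount (bRec n) q := by
  unfold blockCount
  rw [shift_zero _ (by norm_num)]
  congr 1
  ext j
  simp only [mem_filter, mem_range, and_congr_right_iff]
  intro hj
  by_cases hj6 : j = 6
  · subst hj6
    have e7 : shift (bRec n) 7 7 = bRec n 7 + 1 := by simp [shift]
    rw [show (6 : ℕ) + 1 = 7 from rfl, e7, bRec_zero_toNat]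
    have h7 : (bRec n 7).toNat = 11 * n := bRec_succ_toNat n 6 (by norm_num)
    have h7' : (bRec n 7 + 1).toNat = 11 * n + 1 := by
      have : bRec n 7 = ((11 * n : ℕ) : ℤ) := by simp [bRec]; ring
      rw [this]; norm_cast
    rw [h7, h7']
    simp only [block, mem_Icc]
    omega
  · have : shift (bRec n) 7 (j + 1) = bRec n (j + 1) := by
      simp [shift, Function.update_of_ne (show j + 1 ≠ 7 by omega)]
    rw [this]

/-- **`netExp (b(n)+e₇) q = netExp (b(n)) q`** for `q ∉ {11n, 30n}`. -/
theorem netExp_shift7 (n q : ℕ) (h1 : q ≠ 11 * n) (h2 : q ≠ 30 * n) :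
    netExp (shift (bRec n) 7) q = netExp (bRec n) q := by
  unfold netExp
  rw [blockCount_shift7 n q h1 h2, shift_zero _ (by norm_num)]

/-! ### §3 The residue classes for `14n < p < 15n` -/

section Classes

variable {n p : ℕ} (hn : 1 ≤ n) (hp : 14 * n < p) (hp' : p < 15 * n)

include hp hp' in
/-- **The class of `x < p`**: `{x, x+p, x+2p}` if `x + 2p ≤ 41n`, else `{x, x+p}`. -/
theorem classSet_bRec {x : ℕ} (hx : x < p) :
    classSet (bRec n) p x = if x + 2 * p ≤ 41 * n then {x, x + p, x + 2 * p} else {x, x + p} := by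
  ext s
  rw [mem_classSet_iff, bRec_zero_toNat]
  have key : (s ≤ 41 * n ∧ (p : ℤ) ∣ (s : ℤ) - x) ↔ (s = x ∨ s = x + p ∨ (s = x + 2 * p ∧ x + 2 * p ≤ 41 * n)) := by
    constructor
    · rintro ⟨hs, k, hk⟩
      have hk0 : 0 ≤ k := by
        by_contra hneg
        push Not at hneg
        have : (p : ℤ) * k ≤ (p : ℤ) * (-1) := mul_le_mul_of_nonneg_left (by omega) (by omega)
        omega
      have hk3 : k < 3 := by
        by_contra hge
        push Not at hge
        have : (p : ℤ) * 3 ≤ (p : ℤ) * k := mul_le_mul_of_nonneg_left hge (by omega)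
        omega
      interval_cases k <;> omega
    · rintro (rfl | rfl | ⟨rfl, h⟩)
      · exact ⟨by omega, 0, by ring⟩
      · exact ⟨by omega, 1, by push_cast; ring⟩
      · exact ⟨h, 2, by push_cast; ring⟩
  rw [key]
  split_ifs with h3
  · simp only [mem_insert, mem_singleton]; tauto
  · simp only [mem_insert, mem_singleton]
    constructor
    · rintro (h | h | ⟨h, h'⟩)
      · exact Or.inl h
      · exact Or.inr h
      · exact absurd h' h3
    · rintro (h | h)
      · exact Or.inl h
      · exact Or.inr (Or.inl h)

end Classes

/-! ### §4 The minimal multipole classes -/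

/-- Type `(−1,−3)`: `x ∈ [12n, 13n)`, `x + p ≤ 27n`, no third point. -/
def MinA (n p : ℕ) : Finset ℕ := (range p).filter fun x => 12 * n ≤ x ∧ x + p ≤ 27 * n ∧ 41 * n < x + 2 * p

/-- Type `(−2,−2)`: `x ∈ [13n, 14n)`, `x + p ≤ 28n`, not self-conjugate (`2x + p ≠ 41n`). -/
def MinS (n p : ℕ) : Finset ℕ := (range p).filter fun x => 13 * n ≤ x ∧ x + p ≤ 28 * n ∧ 2 * x + p ≠ 41 * n

/-- Type `(−3,−1)`: `x ∈ [14n, p)`, `x + p ≤ 29n` — the conjugates `41n − x' − p` of the classes `x' ∈ MinA`. -/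
def MinAbar (n p : ℕ) : Finset ℕ := (range p).filter fun x => 14 * n ≤ x ∧ x + p ≤ 29 * n

/-- All minimal multipole classes. -/
def MinAll (n p : ℕ) : Finset ℕ := MinA n p ∪ MinS n p ∪ MinAbar n p

/-- Membership in `MinA`. -/
theorem mem_minA {n p x : ℕ} : x ∈ MinA n p ↔ x < p ∧ 12 * n ≤ x ∧ x + p ≤ 27 * n ∧ 41 * n < x + 2 * p := by
  simp [MinA]

/-- Membership in `MinS`. -/
theorem mem_minS {n p x : ℕ} : x ∈ MinS n p ↔ x < p ∧ 13 * n ≤ x ∧ x + p ≤ 28 * n ∧ 2 * x + p ≠ 41 * n := by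
  simp [MinS]

/-- Membership in `MinAbar`. -/
theorem mem_minAbar {n p x : ℕ} : x ∈ MinAbar n p ↔ x < p ∧ 14 * n ≤ x ∧ x + p ≤ 29 * n := by
  simp [MinAbar]

/-- `MinAll ⊆ range p`. -/
theorem minAll_subset (n p : ℕ) : MinAll n p ⊆ range p := by
  intro x hx
  simp only [MinAll, mem_union, mem_minA, mem_minS, mem_minAbar] at hx
  rw [mem_range]
  rcases hx with (h | h) | h
  · exact h.1
  · exact h.1
  · exact h.1

/-- `MinA` and `MinS` are disjoint. -/
theorem disjoint_minA_minS (n p : ℕ) : Disjoint (MinA n p) (MinS n p) := by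
  rw [Finset.disjoint_left]
  intro x hA hS
  rw [mem_minA] at hA; rw [mem_minS] at hS
  omega

/-- `MinA ∪ MinS` and `MinAbar` are disjoint (for `p < 15n`). -/
theorem disjoint_minAS_minAbar {n p : ℕ} (hp' : p < 15 * n) : Disjoint (MinA n p ∪ MinS n p) (MinAbar n p) := by
  rw [Finset.disjoint_left]
  intro x hAS hB
  rw [mem_union, mem_minA, mem_minS] at hAS; rw [mem_minAbar] at hB
  omega

section MinExps

variable {n p : ℕ} (hn : 1 ≤ n) (hp : 14 * n < p) (hp' : p < 15 * n)

include hn hp hp' in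
/-- Net exponents of a class of `MinA`: `(−1, −3)`, also for `b(n) + e₇`; and the two-point shape data. -/
theorem netExp_minA {x : ℕ} (hx : x ∈ MinA n p) :
    netExp (bRec n) x = -1 ∧ netExp (bRec n) (x + p) = -3 ∧
    netExp (shift (bRec n) 7) x = -1 ∧ netExp (shift (bRec n) 7) (x + p) = -3 ∧
    x < p ∧ x + p ≤ 41 * n ∧ 41 * n < x + 2 * p := by
  rw [mem_minA] at hx
  obtain ⟨hxp, h12, h27, h41⟩ := hx
  have e1 : netExp (bRec n) x = -1 := by
    rw [netExp_bRec_of_ne n x (by omega), dep7_lower (by norm_num : 2 ≤ 7) (by omega) (by omega)]; norm_num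
  have e2 : netExp (bRec n) (x + p) = -3 := by
    rw [netExp_bRec_of_ne n (x + p) (by omega), dep7_upper (by norm_num : 4 ≤ 7) (by omega) (by omega)]; norm_num
  refine ⟨e1, e2, ?_, ?_, hxp, by omega, h41⟩
  · rw [netExp_shift7 n x (by omega) (by omega), e1]
  · rw [netExp_shift7 n (x + p) (by omega) (by omega), e2]

include hn hp hp' in
/-- Net exponents of a class of `MinS`: `(−2, −2)`, also for `b(n) + e₇`; and the two-point shape data. -/
theorem netExp_minS {x : ℕ} (hx : x ∈ MinS n p) :
    netExp (bRec n) x = -2 ∧ netExp (bRec n) (x + p) = -2 ∧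
    netExp (shift (bRec n) 7) x = -2 ∧ netExp (shift (bRec n) 7) (x + p) = -2 ∧
    x < p ∧ x + p ≤ 41 * n ∧ 41 * n < x + 2 * p := by
  rw [mem_minS] at hx
  obtain ⟨hxp, h13, h28, -⟩ := hx
  have e1 : netExp (bRec n) x = -2 := by
    rw [netExp_bRec_of_ne n x (by omega), dep7_lower (by norm_num : 3 ≤ 7) (by omega) (by omega)]; norm_num
  have e2 : netExp (bRec n) (x + p) = -2 := by
    rw [netExp_bRec_of_ne n (x + p) (by omega), dep7_upper (by norm_num : 3 ≤ 7) (by omega) (by omega)]; norm_num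
  refine ⟨e1, e2, ?_, ?_, hxp, by omega, by omega⟩
  · rw [netExp_shift7 n x (by omega) (by omega), e1]
  · rw [netExp_shift7 n (x + p) (by omega) (by omega), e2]

/-- The conjugation `x ↦ 41n − (x+p)` maps `MinA` onto `MinAbar` … -/
theorem conj_mem_minAbar {x : ℕ} (hx : x ∈ MinA n p) : 41 * n - (x + p) ∈ MinAbar n p := by
  rw [mem_minA] at hx; rw [mem_minAbar]; omega

include hp in
/-- … and `MinAbar` back onto `MinA` … -/
theorem conj_mem_minA {x : ℕ} (hx : x ∈ MinAbar n p) : 41 * n - (x + p) ∈ MinA n p := by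
  rw [mem_minAbar] at hx; rw [mem_minA]; omega

include hp in
/-- … and `MinS` onto itself. -/
theorem conj_mem_minS {x : ℕ} (hx : x ∈ MinS n p) : 41 * n - (x + p) ∈ MinS n p := by
  rw [mem_minS] at hx ⊢; omega

end MinExps

end Summit.KontsevichZagierPeriods.Zeta5Search.CellA
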